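import Literature.MathematicalPhysics.QuantumFieldTheory.Balaban1983to89.B9MultiscaleSmoothPartitionY
import Literature.MathematicalPhysics.QuantumFieldTheory.Balaban1983to89.B6TorusGeodesicWalks
import Literature.MathematicalPhysics.QuantumFieldTheory.Balaban1983to89.B6AgmonExponentMultiLevelTorus
import Literature.MathematicalPhysics.QuantumFieldTheory.Balaban1983to89.B9CoReadingCoordsL2S
import Literature.MathematicalPhysics.QuantumFieldTheory.Balaban1983to89.B9GeoLemma21KLevelV1

/-!
# `Balaban1983to89.B9MultiscaleSmoothPartitionYNear` — THE ENLARGEMENT RADIUS OF dag-n06-l's NEIGHBOURHOODS `NearY` IN THE BLOCK DISTANCE (2.46): a site `z`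
# with `NearY i y z` (torus distance `< 3·L^{j(y)}` from the centre of the carrier block `β y`) has its block within `d_T ≤ 7(d+1)L² + 1` of `β y`, hence its
# index bond within `7(d+1)L² + 2` of `y` in def-Y's reading distance — the `hN` input of the enlargement adapter `B11SectGSmoothCutAdapters`

[4] = T. Bałaban, *Propagators and renormalization transformations for lattice gauge theories. II*, Commun. Math. Phys. **96** (1984) 223–250
[`Balaban1984PropagatorsII`]; [B9] = T. Bałaban, *Propagators for lattice gauge theories in a background field*, Commun. Math. Phys. **99** (1985) 389–434
[`Balaban1985BackgroundPropagators`].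

statement-level skeleton of published theorems with citation tags; proofs where landed; nothing here is a claim about the
Yang–Mills mass gap

THE PRINTED LOCI.  [4] (2.46) p. 231 (the block distance `d(y,y′)`), p. 231–232 (*"d(x, x′) = d(y, y′) if x ∈ B^j(y)"*), (2.1)–(2.2) p. 224 (the two-level
window); [B9] (3.43) p. 398 (the enlarged block `Δ̃(y)` carrying the smooth cut-off `ζ`).

WHY THIS FILE (cell `pub-ymgap`, node N06, width seat `pub-ymgap-dag-n06-w6` g2; LAYER B of the enlargement adapter, worded YES by dag-n06-l g20).  The smooth-partition
class `B11SectGSmoothCut.BlockNorm.ofSmoothPartition` at dag-n06-l's datum (`B9MultiscaleSmoothPartitionY.zeta`, neighbourhoods `NearY i y z :⇔ rad i y z < 3`)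
reads a producer's sup entry on the enlarged neighbourhood; the producers' kernels decay in the BLOCK distance `d_T`.  `B11SectGSmoothCutAdapters.pointBound_enlarge_
of_hasMaj_ofBlocks` needs `hN : NearY y x → d(y, blk x) ≤ r`.  THIS FILE proves it with a member-uniform `r`:
* ★★ `distT_carrier_blkOf_le_of_nearY` — `NearY i y z ⇒ d_T(β y, blkOf z) ≤ rNear d ℓ := 7(d+1)(ℓ+1)² + 1`: dag-n06-l's `exists_site_of_nearY` gives a site `t ∈ β y`
  with `|z − t|_T ≤ 7∕2·L^{j(y)}`; the staircase walk `t ⇝ z` inside the torus sup-ball (`B6TorusGeodesicWalks.exists_ballWalk`, length `≤ (d+1)|z − t|_T`) stays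
  in the two-level window of [4] (2.2) (`levY_window`: levels `≥ j(y) − 1`), so its weighted length is `≤ 7∕2·(d+1)·L` (`wtLen_le_length_mul`), and
  `B6AgmonExponentMultiLevelTorus.distT_blkOf_le_of_walk` (`d_T ≤ 2L·W + 1`) concludes;
* ★ `dist_sIK_le_of_nearY` — with a 1-faithful index map `bI` (`sIK_dist_le_one`): `(geo9K i).dist y (sIK i bI z) ≤ rNear d ℓ + 1`;
* `hN_nearY` — the `hN` binder of the adapters at the site carrier `XSK κ i` (`N y p := NearY i y p.1`, `blk p := sIK i bI p.1`).
HONEST SCOPE.  Finite-lattice geometry of one k-level torus family at a time; the constant `7(d+1)(ℓ+1)² + 2` is ours and not optimised; nothing of [4] or [B9]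
asserted; no pin, no schema; COUNT-NEUTRAL; N06 NOT discharged; nothing continuum, nothing about the mass gap.  Cell `pub-ymgap` (HUMAN RULING D-0062), Track A
node N06 [B9], width seat `pub-ymgap-dag-n06-w6` (g2), 2026-08-28.
-/

noncomputable section

namespace Literature.MathematicalPhysics.QuantumFieldTheory.Balaban1983to89.B9MultiscaleSmoothPartitionYNear

open B4TorusKernel.MultiPeriod (torusSupNorm torusSupNorm_nonneg)
open B6MultiLevelTorusOperator (one_le_N0 TDomains)
open B6Geom246MultiLevelBox (bset blkOf)
open B6Geom246MultiLevelTorus (bondT geomT)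
open B6Ineq2142KLevelV1 (β lvl)
open B6KLevelCensusIndexV1 (KIdx)
open B6TorusSiteWalks (latGraphT wtLen wtLen_nonneg)
open B6TorusGeodesicWalks (exists_ballWalk wtLen_le_length_mul)
open B6AgmonExponentMultiLevelTorus (distT_blkOf_le_of_walk)
open B9GeoNormsKLevelV1 (geo9K)
open B9GeoLemma21KLevelV1 (geo9K_dist_eq)
open B9CoReadingCoordsS (XSK sIK blkV1_site)
open B9CoReadingCoordsL2S (sIK_dist_le_one)
open B9MultiscaleSmoothPartitionY (NearY scl scl_pos exists_site_of_nearY levY_window)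
open Node00 (SiteY FBondY IBondY toKT)
open B6GlobalChartV1 (blkV1)

variable {d ℓ : ℕ} {hd : 1 ≤ d + 1} {hL : Odd (ℓ + 1) ∧ 1 < ℓ + 1} {b₀ b₁ : ℝ}
variable (i : KIdx d ℓ hd hL b₀ b₁)

/-- the enlargement radius of `NearY` in the block distance (ours, not optimised): `7(d+1)(ℓ+1)² + 1`. [cite: Balaban1984PropagatorsII, (2.46) p.231, bookkeeping] -/
def rNear (d ℓ : ℕ) : ℝ := 7 * ((d : ℝ) + 1) * (((ℓ + 1 : ℕ) : ℝ)) ^ 2 + 1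

omit i in
/-- `0 ≤ rNear`. [cite: Balaban1984PropagatorsII, (2.46) p.231, bookkeeping] -/
theorem rNear_nonneg (d ℓ : ℕ) : 0 ≤ rNear d ℓ := by unfold rNear; positivity

/-- ★★ **THE BLOCK OF A SITE OF `Δ̃(y)` IS WITHIN `7(d+1)L² + 1` ADMISSIBLE BONDS OF THE CARRIER BLOCK `β y`**: `NearY i y z ⇒ d_T(β y, blkOf z) ≤ rNear d ℓ`
(staircase walk in the torus sup-ball of radius `7∕2·L^{j(y)}` around a site of `β y`, which lies in the two-level window of (2.2); `d_T ≤ 2L·W + 1`).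
[cite: Balaban1984PropagatorsII, (2.46) p.231 + p.231–232 («d(x, x′) = d(y, y′)») + (2.2) p.224; Balaban1985BackgroundPropagators, (3.43) p.398 («Δ̃(y)»)] -/
theorem distT_carrier_blkOf_le_of_nearY {y : IBondY i} {z : SiteY i} (h : NearY i y z) :
    (((bondT i.D).dist (β i.hN i.D i.hk y) (blkOf i.D.toDomains z) : ℕ) : ℝ) ≤ rNear d ℓ := by
  obtain ⟨t, hbt, hlt, hdt⟩ := exists_site_of_nearY i h
  obtain ⟨p, hlen, hball⟩ := exists_ballWalk t z
  have hL1 : (1 : ℝ) ≤ ((ℓ + 1 : ℕ) : ℝ) := by exact_mod_cast Nat.succ_le_succ (Nat.zero_le ℓ)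
  have hL0 : (0 : ℝ) < ((ℓ + 1 : ℕ) : ℝ) := by positivity
  -- the scale of `y` and the level of `t`
  have hj1 : 1 ≤ lvl i.hN i.D i.hk y := by rw [← hlt]; exact (toKT i).D.one_le_lev t.1
  have hscl : scl i y = (((ℓ + 1 : ℕ) : ℝ)) ^ lvl i.hN i.D i.hk y := rfl
  -- every site of the walk lies in the two-level window: level ≥ j(y) − 1
  have hJ : ∀ v ∈ p.support, lvl i.hN i.D i.hk y - 1 ≤ i.D.lev v.1 := by
    intro v hv
    have h6 : torusSupNorm (toKT i).NB (v.1 - t.1) ≤ 6 * (((ℓ + 1 : ℕ) : ℝ)) ^ Node00.levY i t := by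
      rw [hlt]
      calc torusSupNorm (toKT i).NB (v.1 - t.1) ≤ torusSupNorm (toKT i).NB (z.1 - t.1) := hball v hv
        _ ≤ 7 / 2 * scl i y := hdt
        _ ≤ 6 * (((ℓ + 1 : ℕ) : ℝ)) ^ lvl i.hN i.D i.hk y := by rw [hscl]; nlinarith [pow_pos hL0 (lvl i.hN i.D i.hk y)]
    have hw := (levY_window i h6).1
    rw [hlt] at hw
    show lvl i.hN i.D i.hk y - 1 ≤ (toKT i).D.lev v.1
    have : Node00.levY i v = (toKT i).D.lev v.1 := rfl
    omega
  -- the weighted length of the walk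
  have hw : wtLen i.D p ≤ (p.length : ℝ) * ((((ℓ + 1) ^ (lvl i.hN i.D i.hk y - 1) : ℕ) : ℝ))⁻¹ := wtLen_le_length_mul i.D p hJ
  have hpow : (((ℓ + 1 : ℕ) : ℝ)) ^ lvl i.hN i.D i.hk y = ((((ℓ + 1) ^ (lvl i.hN i.D i.hk y - 1) : ℕ) : ℝ)) * ((ℓ + 1 : ℕ) : ℝ) := by
    rw [Nat.cast_pow]
    conv_lhs => rw [← Nat.sub_add_cancel hj1, pow_succ]
  have hLj0 : (0 : ℝ) < ((((ℓ + 1) ^ (lvl i.hN i.D i.hk y - 1) : ℕ) : ℝ)) := by positivity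
  have hlen' : (p.length : ℝ) ≤ ((d : ℝ) + 1) * (7 / 2 * (((((ℓ + 1) ^ (lvl i.hN i.D i.hk y - 1) : ℕ) : ℝ)) * ((ℓ + 1 : ℕ) : ℝ))) := by
    rw [← hpow, ← hscl]
    exact hlen.trans (mul_le_mul_of_nonneg_left hdt (by positivity))
  have hw' : wtLen i.D p ≤ ((d : ℝ) + 1) * (7 / 2) * ((ℓ + 1 : ℕ) : ℝ) := by
    refine hw.trans ?_
    rw [← div_eq_mul_inv, div_le_iff₀ hLj0]
    nlinarith [hlen']
  -- `d_T ≤ 2L·W + 1`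
  have hR : 1 ≤ i.R := le_trans (by nlinarith [Nat.one_le_pow 2 (ℓ + 1) (Nat.succ_pos ℓ)]) i.hR2
  have hMh : 1 ≤ i.Mh := le_trans (by norm_num) i.hM8
  have hP : ∀ μ, 1 ≤ i.P' μ := fun μ => le_trans (by norm_num) (i.hP5 μ)
  have hℓ : 1 ≤ ℓ := le_trans (by norm_num) i.hℓ
  have hdist := distT_blkOf_le_of_walk i.D hR hMh hP hℓ p
  rw [hbt] at hdist
  refine hdist.trans ?_
  unfold rNear
  have : 2 * ((ℓ + 1 : ℕ) : ℝ) * wtLen i.D p ≤ 7 * ((d : ℝ) + 1) * (((ℓ + 1 : ℕ) : ℝ)) ^ 2 := by nlinarith [hw', hL0]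
  linarith

/-- ★ **IN def-Y's READING DISTANCE**: with a 1-faithful index map `bI` (the certificate's pin `hβ1`), the index bond of the class of a site `z ∈ Δ̃(y)` is within
`rNear d ℓ + 1` of `y`: `(geo9K i).dist y (sIK i bI z) ≤ rNear d ℓ + 1`. [cite: Balaban1984PropagatorsII, (2.45)–(2.46) p.231; Balaban1985BackgroundPropagators, (3.43) p.398] -/
theorem dist_sIK_le_of_nearY {bI : FBondY i → IBondY i} (hβ1 : ∀ x : FBondY i, (geomT i.D).dist (β i.hN i.D i.hk (bI x)) (blkV1 i.hN i.D x) ≤ 1)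
    {y : IBondY i} {z : SiteY i} (h : NearY i y z) : (geo9K i).dist y (sIK i bI z) ≤ rNear d ℓ + 1 := by
  have hMh : 1 ≤ i.Mh := le_trans (by norm_num) i.hM8
  have hP : ∀ μ, 1 ≤ i.P' μ := fun μ => le_trans (by norm_num) (i.hP5 μ)
  have h1 := distT_carrier_blkOf_le_of_nearY i h
  have h2 : (geomT i.D).dist (blkOf i.D.toDomains z) (β i.hN i.D i.hk (sIK i bI z)) ≤ 1 := by
    rw [B6HolderPairInputsV1.geomT_dist_comm]; exact sIK_dist_le_one i hβ1 z
  rw [geo9K_dist_eq]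
  calc (((bondT i.D).dist (β i.hN i.D i.hk y) (β i.hN i.D i.hk (sIK i bI z)) : ℕ) : ℝ)
      = (geomT i.D).dist (β i.hN i.D i.hk y) (β i.hN i.D i.hk (sIK i bI z)) := rfl
    _ ≤ (geomT i.D).dist (β i.hN i.D i.hk y) (blkOf i.D.toDomains z) + (geomT i.D).dist (blkOf i.D.toDomains z) (β i.hN i.D i.hk (sIK i bI z)) :=
        B6HolderPairInputsV1.geomT_dist_triangle hMh hP _ _ _
    _ ≤ rNear d ℓ + 1 := add_le_add h1 h2

/-- the `hN` binder of `B11SectGSmoothCutAdapters.pointBound_enlarge_of_hasMaj_ofBlocks` ∕ `hasMaj_into_ofSmoothPartition_of_blockMaj` at the SITE carrier `XSK κ i` with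
neighbourhoods `N y p := NearY i y p.1` and block map `blk p := sIK i bI p.1`: radius `rNear d ℓ + 1`.
[cite: Balaban1984PropagatorsII, (2.46) p.231 + (2.51) p.232; Balaban1985BackgroundPropagators, (3.43) p.398] -/
theorem hN_nearY {κ : Type} {bI : FBondY i → IBondY i} (hβ1 : ∀ x : FBondY i, (geomT i.D).dist (β i.hN i.D i.hk (bI x)) (blkV1 i.hN i.D x) ≤ 1) :
    ∀ (y : IBondY i) (p : XSK κ i), NearY i y p.1 → (geo9K i).dist y (sIK i bI p.1) ≤ rNear d ℓ + 1 :=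
  fun _ p hp => dist_sIK_le_of_nearY i hβ1 (z := p.1) hp

end Literature.MathematicalPhysics.QuantumFieldTheory.Balaban1983to89.B9MultiscaleSmoothPartitionYNear
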